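import Mathlib.Logic.Hydra
import Mathlib.Data.Prod.Lex
import Mathlib.Order.WellFounded
import HarnessLib

/-!
# [OURS · L1 W4.2] Toric marked monomial objects in dimension 3 — brick 6B: DERSHOWITZ–MANNA DESCENT (multiset plumbing)

[OURS · L1 W4.2 · seat res-L1-s42-pv-2 gen 5] Memo `L/res-L1-s42-pv-2/CALIBRATION-W42-O2-v4.md` §3 (F6).  Abstract facts about the transitive
closure `DM r` of Mathlib's `Relation.CutExpand r` («replace one element by finitely many `r`-smaller ones») on multisets, in the form the phase
descent needs: (1) replacing EVERY element `i` of a non-empty index multiset `I` (valued by `f i`) by a multiset `B i` of strictly smaller values is a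
`DM`-step chain (`dm_replace`); (2) dropping elements is a `DM`-step chain or the identity (`dm_of_le`); (3) hence `M' ≤ A + I.bind B` with
`I ≠ 0` and `∀ i ∈ I, ∀ b ∈ B i, r b (f i)` gives `DM r M' (A + I.map f)` (`dm_of_le_replace`); (4) `DM r` is well founded when `r` is
(`wellFounded_dm`).  Nothing toric here.  [folklore: Dershowitz–Manna 1979]  AI work, weaker than expert review.  Pure proofs, no `sorry`, no new axiom.
-/

set_option linter.dupNamespace false -- mandated namespace of this single-conjunct summit

namespace Summit.ResolutionOfSingularities.ResolutionOfSingularities.Theorems.CampaignW42.Toric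

namespace Descent

variable {α κ : Type}

/-- **[OURS · L1 W4.2]** The Dershowitz–Manna step relation: transitive closure of `Relation.CutExpand r`. -/
def DM (r : α → α → Prop) : Multiset α → Multiset α → Prop := Relation.TransGen (Relation.CutExpand r)

/-- `DM r` is well founded when `r` is. -/
theorem wellFounded_dm {r : α → α → Prop} (hr : WellFounded r) : WellFounded (DM r) :=
  (hr.cutExpand).transGen

/-- `DM` is transitive. -/
theorem DM.trans {r : α → α → Prop} {a b c : Multiset α} (h₁ : DM r a b) (h₂ : DM r b c) : DM r a c :=
  Relation.TransGen.trans h₁ h₂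

/-- One cut-expand step is a `DM` step. -/
theorem dm_of_cutExpand {r : α → α → Prop} {a b : Multiset α} (h : Relation.CutExpand r a b) : DM r a b :=
  Relation.TransGen.single h

/-- Removing one element is a cut-expand step (expansion by the empty multiset). -/
theorem cutExpand_erase_one {r : α → α → Prop} (s : Multiset α) (a : α) : Relation.CutExpand r s (s + {a}) :=
  ⟨0, a, fun _ h => absurd h (Multiset.notMem_zero _), by rw [add_zero]⟩

/-- `DM` is invariant under adding the same multiset on the left. -/
theorem DM.add_left {r : α → α → Prop} {t u : Multiset α} (s : Multiset α) (h : DM r t u) : DM r (s + t) (s + u) := by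
  induction h with
  | single hst => exact dm_of_cutExpand ((Relation.cutExpand_add_left s).mpr hst)
  | tail _ hbc ih => exact ih.tail ((Relation.cutExpand_add_left s).mpr hbc)

/-- Dropping elements: `M' ≤ M` implies `M' = M` or `DM r M' M`. -/
theorem dm_of_le {r : α → α → Prop} {M' M : Multiset α} (h : M' ≤ M) : M' = M ∨ DM r M' M := by
  obtain ⟨E, rfl⟩ := Multiset.le_iff_exists_add.mp h
  clear h
  induction E using Multiset.induction with
  | empty => left; rw [add_zero]
  | cons e E ih =>
    right
    have hstep : Relation.CutExpand r (M' + E) (M' + (e ::ₘ E)) := by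
      have : M' + (e ::ₘ E) = (M' + E) + {e} := by
        rw [← Multiset.singleton_add, add_comm {e} E, add_assoc]
      rw [this]; exact cutExpand_erase_one _ _
    rcases ih with heq | hdm
    · rw [← heq] at hstep; exact dm_of_cutExpand hstep
    · exact hdm.tail hstep

/-- **Replacement.**  Replacing every element `f i` (`i ∈ I`, `I ≠ 0`) by a multiset `B i` of `r`-smaller elements is a `DM` chain:
`DM r (A + I.bind B) (A + I.map f)`. -/
theorem dm_replace {r : α → α → Prop} (A : Multiset α) (I : Multiset κ) (f : κ → α) (B : κ → Multiset α)
    (hB : ∀ i ∈ I, ∀ b ∈ B i, r b (f i)) (hI : I ≠ 0) : DM r (A + I.bind B) (A + I.map f) := by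
  induction I using Multiset.induction generalizing A with
  | empty => exact absurd rfl hI
  | cons i I ih =>
    have hi : ∀ b ∈ B i, r b (f i) := hB i (Multiset.mem_cons_self i I)
    have hI' : ∀ i' ∈ I, ∀ b ∈ B i', r b (f i') := fun i' hi' => hB i' (Multiset.mem_cons_of_mem hi')
    -- the last step: replace `f i` by `B i` next to `A + I.map f`
    have h1 : DM r (A + I.map f + B i) (A + I.map f + {f i}) :=
      DM.add_left _ (dm_of_cutExpand (Relation.cutExpand_singleton hi))
    have e1 : A + (i ::ₘ I).map f = A + I.map f + {f i} := by
      rw [Multiset.map_cons, ← Multiset.singleton_add, add_comm {f i} (I.map f), add_assoc]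
    have e2 : A + (i ::ₘ I).bind B = (A + B i) + I.bind B := by
      rw [Multiset.cons_bind, add_assoc]
    rw [e1, e2]
    by_cases hI0 : I = 0
    · subst hI0
      rw [Multiset.zero_bind, add_zero, Multiset.map_zero, add_zero]
      rw [Multiset.map_zero, add_zero] at h1
      exact h1
    · have h2 := ih (A + B i) hI' hI0
      have e3 : A + B i + I.map f = A + I.map f + B i := by
        rw [add_assoc, add_comm (B i), ← add_assoc]
      rw [e3] at h2
      exact h2.trans h1

/-- **The form used by the phase descent.**  If `M' ≤ A + I.bind B` with `I ≠ 0` and every `B i` consists of elements `r`-below `f i`, then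
`DM r M' (A + I.map f)`. -/
theorem dm_of_le_replace {r : α → α → Prop} {M' : Multiset α} (A : Multiset α) (I : Multiset κ) (f : κ → α) (B : κ → Multiset α)
    (hB : ∀ i ∈ I, ∀ b ∈ B i, r b (f i)) (hI : I ≠ 0) (hle : M' ≤ A + I.bind B) : DM r M' (A + I.map f) := by
  rcases dm_of_le (r := r) hle with heq | hdm
  · rw [heq]; exact dm_replace A I f B hB hI
  · exact hdm.trans (dm_replace A I f B hB hI)

end Descent

end Summit.ResolutionOfSingularities.ResolutionOfSingularities.Theorems.CampaignW42.Toric
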